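import Summits.CriticalPhenomena.PercolationContinuityZ3.Theorems.PercNearOneGluingNoHeavyLowerTailAntitheticSepCodes
import HarnessLib

/-!
# `NoHeavyLowerTail` (stmt-CriticalPhenomena-4575) — antithetic cluster pairs: STRING-ENCODED separable certificates (parser; prim-hp-2 gen 67,
# HOME/MEMO-gen67.md §3(c))

Support file (`--supports stmt-CriticalPhenomena-4575`, hull-port prover `prim-hp-2`, gen 67).  COMPUTABLE DEFINITIONS ONLY; no named facts, no
sorries; standard axioms.

WHY.  A separable certificate (…AntitheticSepCodes / …AntitheticSepDecide) has a few thousand entries `(a, b, a', b', c)`; written as a `List`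
literal it elaborates to a term of nesting depth ≈ its length, which needs `set_option maxRecDepth` in the instance file and made the gate's
certificate re-verification fail ("pending-cert … error", p585209).  Passing the certificate as ONE string literal keeps the term shallow:
`SepCert.check n N h (SepCert.parseCert "a b a' b' c a b …")` is evaluated natively by `native_decide`, and `SepCert.shift_nonneg_of_sep` accepts
any certificate list, parsed or literal — no soundness obligation on the parser (a wrong parse can only make `check` fail).
* `Antithetic.SepCert.parseNats` — the naturals in a space-separated string; `group5` — consecutive quintuples; `parseCert = group5 ∘ parseNats`;
  `parseHist` — triples `(x, y, m)` likewise (for long histograms).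
[cite: VandenbergHaggstromKahn2005, §1 p. 6 ("Harris' inequality")]
-/

namespace Summit.CriticalPhenomena.PercolationContinuityZ3.Theorems

namespace Antithetic

namespace SepCert

/-- The naturals written (in decimal) in a space-separated string; non-numeric tokens are skipped. [this work] -/
def parseNats (s : String) : List ℕ := (s.splitOn " ").filterMap fun t => t.toNat?

/-- Consecutive quintuples of a list (a trailing incomplete group is dropped). [this work] -/
def group5 : List ℕ → List (ℕ × ℕ × ℕ × ℕ × ℕ)
  | a :: b :: c :: d :: e :: t => (a, b, c, d, e) :: group5 t
  | _ => []

/-- Consecutive triples of a list. [this work] -/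
def group3 : List ℕ → List (ℕ × ℕ × ℕ)
  | a :: b :: c :: t => (a, b, c) :: group3 t
  | _ => []

/-- A separable certificate `(a, b, a', b', c) …` read from a string. [this work] -/
def parseCert (s : String) : List (ℕ × ℕ × ℕ × ℕ × ℕ) := group5 (parseNats s)

/-- A histogram `(x, y, m) …` read from a string. [this work] -/
def parseHist (s : String) : List (ℕ × ℕ × ℕ) := group3 (parseNats s)

end SepCert

end Antithetic

end Summit.CriticalPhenomena.PercolationContinuityZ3.Theorems
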